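import Summits.BirchSwinnertonDyer.BirchSwinnertonDyer.Theorems.GenusKolyvaginAtTwoTorsionCellSELTwistRows
import Summits.BirchSwinnertonDyer.BirchSwinnertonDyer.Theorems.GenusKolyvaginAtTwoTorsionCellSELLaplacianParity
import HarnessLib

/-!
# SEL (iso-class Selmer pair law), V-d: Selmer classes of the iso-class twist ⟷ solutions of `Φ₃(Ĝ)χ = c𝟙`

Crux R″ `RankOneTwoTorsionResidualAtTwo` (stmt-27478), LINE 49 «full_vertex», SUPPORT stub SEL
`IsoClassSelmerPairLawAtTwo`, `C₀` half.  Setting of parts II–IV (`E` of rank `0` with `Ш(E)[2] = 0`, full-admissible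
iso-class `Q` of even size, `M = ∏_{q∈Q} q`).  This file joins the arithmetic (parts III, IV, V-c) with the linear algebra
(parts V-a, V-b) through INDICATOR VECTORS `χ_A(i) = [i ∈ A]` of subsets `A ⊆ Q`:

* `exists_finset_of_indicator` / `finset_eq_of_indicator_eq` / `even_card_of_sum_indicator_eq_zero` — vectors
  `↥Q → 𝔽₂` versus subsets of `Q`.
* **`twoDescentClass_mem_selmerGroup_of_phi3`** — for a Selmer pair `(t₁,t₂)` of `E` with constant bits `(τ₁,τ₂)` on
  `Q` and a solution `χ` of `Φ₃(Ĝ)χ = (τ₂ + (ε+1)τ₁)𝟙`, with `A` the support of `χ` and `B` the support of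
  `τ₁𝟙 + (Ĝ+εI)χ`: `c_{E^{(M)}}(t₁∏_A i, t₂∏_B i) ∈ Sel⁽²⁾(E^{(M)}/ℚ)` (parts V-a/V-b ⟹ rows + evenness ⟹ part IV).
* **`exists_torsion_phi3_of_mem_selmerGroup`** — conversely every Selmer class of `E^{(M)}` arises this way from one of
  the four torsion pairs of `E` (part III ⟹ components, part V-c ⟹ rows, part V-a ⟹ `Φ₃`).

Part V-e turns this into the count `#Sel⁽²⁾(E^{(M)}/ℚ) = 4·#ker Φ₃(Ĝ)`.  Everything is proved; no LINE 49 statement is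
restated; BSD is not advanced by this file alone.

## References

* [SilvermanAEC2009] J. H. Silverman, *The Arithmetic of Elliptic Curves*, 2nd ed., Prop. X.1.4, Prop. X.4.9.
* [Kane2013SelmerTwists] D. M. Kane, Algebra Number Theory 7 (2013), §2.
* [HeathBrown1994SelmerCongruentII] D. R. Heath-Brown, Invent. Math. 118 (1994), §2.
-/

noncomputable section

open scoped Classical

namespace Summit.BirchSwinnertonDyer.BirchSwinnertonDyer.Theorems.GenusKolyvaginAtTwo.TorsionCellSEL

open WeierstrassCurve WeierstrassCurve.Affine WeierstrassCurve.Affine.Point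
open Literature.NumberTheory.GaloisRepresentations Literature.NumberTheory.EllipticCurves Field
open Literature.NumberTheory.EllipticCurves.TwoDescentLocal
open Literature.NumberTheory.EllipticCurves.KramerTwoDescent
open Summit.BirchSwinnertonDyer.BirchSwinnertonDyer.Theorems.GenusKolyvaginAtTwo.TorsionCellD0
open Summit.BirchSwinnertonDyer.BirchSwinnertonDyer.Theorems.GenusKolyvaginAtTwo.FullVertex
open IsDedekindDomain NumberField Rat.HeightOneSpectrum Matrix

/-! ## Indicator vectors -/

section Indicator

variable (Q : Finset ℕ)

/-- Every vector `χ : Q → 𝔽₂` is the indicator vector of a subset of `Q`. [folklore] -/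
theorem exists_finset_of_indicator (χ : Q → ZMod 2) :
    ∃ A : Finset ℕ, A ⊆ Q ∧ ∀ i : Q, χ i = (if (i : ℕ) ∈ A then 1 else 0) := by
  refine ⟨(Finset.univ.filter (fun i : Q => χ i = 1)).map (Function.Embedding.subtype (· ∈ Q)), ?_, ?_⟩
  · intro x hx
    simp only [Finset.mem_map, Finset.mem_filter, Finset.mem_univ, true_and, Function.Embedding.coe_subtype] at hx
    obtain ⟨i, -, rfl⟩ := hx
    exact i.2
  · intro i
    have hmem : ((i : ℕ) ∈ (Finset.univ.filter (fun i : Q => χ i = 1)).map (Function.Embedding.subtype (· ∈ Q))) ↔ χ i = 1 := by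
      simp only [Finset.mem_map, Finset.mem_filter, Finset.mem_univ, true_and, Function.Embedding.coe_subtype]
      constructor
      · rintro ⟨i', hi', heq⟩
        have : i' = i := Subtype.ext heq
        rw [← this]; exact hi'
      · intro h; exact ⟨i, h, rfl⟩
    have h01 : χ i = 0 ∨ χ i = 1 := by generalize χ i = y; revert y; decide
    rcases h01 with h | h
    · rw [h, if_neg (by rw [hmem, h]; exact zero_ne_one)]
    · rw [h, if_pos (hmem.mpr h)]

/-- Two subsets of `Q` with the same indicator vector are equal. [folklore] -/
theorem finset_eq_of_indicator_eq {A A' : Finset ℕ} (hA : A ⊆ Q) (hA' : A' ⊆ Q)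
    (h : ∀ i : Q, (if (i : ℕ) ∈ A then (1 : ZMod 2) else 0) = (if (i : ℕ) ∈ A' then 1 else 0)) : A = A' := by
  ext x
  constructor
  · intro hx
    have := h ⟨x, hA hx⟩
    rw [if_pos hx] at this
    by_contra hx'
    rw [if_neg hx'] at this
    exact one_ne_zero this
  · intro hx
    have := h ⟨x, hA' hx⟩
    rw [if_pos hx] at this
    by_contra hx'
    rw [if_neg hx'] at this
    exact one_ne_zero this.symm

/-- The number of ones of an indicator vector is the size of the set (mod `2`): even iff the sum vanishes. [folklore] -/
theorem even_card_of_sum_indicator_eq_zero {A : Finset ℕ} (hA : A ⊆ Q)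
    (h : ∑ i : Q, (if (i : ℕ) ∈ A then (1 : ZMod 2) else 0) = 0) : Even A.card := by
  have hsum : (∑ i : Q, (if (i : ℕ) ∈ A then (1 : ZMod 2) else 0)) = (A.card : ZMod 2) := by
    rw [Finset.sum_coe_sort Q (fun i => if i ∈ A then (1 : ZMod 2) else 0), ← Finset.sum_filter,
      Finset.filter_mem_eq_inter, Finset.inter_eq_right.mpr hA, Finset.sum_const, nsmul_eq_mul, mul_one]
  rw [hsum] at h
  exact (ZMod.natCast_eq_zero_iff_even).mp h

end Indicator

/-! ## Solutions of `Φ₃` give Selmer classes -/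

section Param

variable (E : WeierstrassCurve ℚ) [E.IsElliptic] {e₁ e₂ e₃ : ℚ} (S Q : Finset ℕ)

/-- **A solution of `Φ₃(Ĝ)χ = (τ₂ + (ε+1)τ₁)𝟙` gives a Selmer class of the iso-class twist.**  Setting of the module
docstring; `(t₁,t₂)` a Selmer pair of `E` (`c_E(t₁,t₂) ∈ Sel⁽²⁾(E/ℚ)`), units at the primes of `Q` with constant residue
bits `τ₁, τ₂`; `χ` a solution; `A ⊆ Q` the support of `χ` and `B ⊆ Q` the support of `τ₁𝟙 + Ĝχ + εχ`.  Then
`c_{E^{(M)}}(t₁ ∏_A i, t₂ ∏_B i) ∈ Sel⁽²⁾(E^{(M)}/ℚ)`. [cite: SilvermanAEC2009, Prop. X.1.4, Prop. X.4.9]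
[cite: Kane2013SelmerTwists, §2] -/
theorem twoDescentClass_mem_selmerGroup_of_phi3 (h : E.toAffine.SplitTwoTorsion e₁ e₂ e₃)
    (hS : ∀ ℓ ∈ S, ℓ.Prime) (h2S : 2 ∈ S)
    (hgood : ∀ ℓ : ℕ, (hℓ : ℓ.Prime) → ℓ ∉ S → haveI : Fact ℓ.Prime := ⟨hℓ⟩;
      padicValRat ℓ (e₁ - e₂) = 0 ∧ padicValRat ℓ (e₁ - e₃) = 0 ∧ padicValRat ℓ (e₂ - e₃) = 0)
    (hN : ∀ ℓ : ℕ, ℓ.Prime → ℓ ∉ S → ¬ ℓ ∣ E.conductorNorm ℤ)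
    (hQ : ∀ q ∈ Q, q.Prime) (hQS : ∀ q ∈ Q, q ∉ S) (hQ4 : ∀ q ∈ Q, q % 4 = 3) (hk : Even Q.card)
    (hiso8 : ∀ q ∈ Q, ∀ q' ∈ Q, q % 8 = q' % 8)
    (hisoS : ∀ q ∈ Q, ∀ q' ∈ Q, ∀ ℓ ∈ S, (hℓ : ℓ.Prime) → ℓ ≠ 2 → haveI : Fact ℓ.Prime := ⟨hℓ⟩;
      legendreSym ℓ ((q : ℤ) * q') = 1)
    (hadm : ∀ q ∈ Q, (hq : q.Prime) → haveI : Fact q.Prime := ⟨hq⟩;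
      qrBit q ((e₁ - e₂) * (e₁ - e₃)) = 1 ∧ qrBit q ((e₂ - e₁) * (e₂ - e₃)) = 1)
    {ε : ZMod 2} (hε : ∀ q ∈ Q, (hq : q.Prime) → haveI : Fact q.Prime := ⟨hq⟩; qrBit q (e₂ - e₁) = ε)
    {d : ℚ} (hd : d = ∏ q ∈ Q, (q : ℚ)) [(E.quadraticTwist d).IsElliptic]
    {t₁ t₂ : ℚˣ} (ht : E.twoDescentClass h t₁ t₂ ∈ E.selmerGroup 2) {τ₁ τ₂ : ZMod 2}
    (hτ : ∀ q ∈ Q, (hq : q.Prime) → haveI : Fact q.Prime := ⟨hq⟩;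
      parityBit q (t₁ : ℚ) = 0 ∧ parityBit q (t₂ : ℚ) = 0 ∧ qrBit q (t₁ : ℚ) = τ₁ ∧ qrBit q (t₂ : ℚ) = τ₂)
    {χ : Q → ZMod 2} (hχ : phi3 (redeiLaplacian Q) *ᵥ χ = fun _ => τ₂ + (ε + 1) * τ₁)
    {A B : Finset ℕ} (hA : A ⊆ Q) (hB : B ⊆ Q)
    (hindA : ∀ i : Q, χ i = (if (i : ℕ) ∈ A then 1 else 0))
    (hindB : ∀ j : Q, τ₁ + (redeiLaplacian Q *ᵥ χ) j + ε * χ j = (if (j : ℕ) ∈ B then 1 else 0))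
    (hpa0 : ∏ i ∈ A, (i : ℚ) ≠ 0) (hpb0 : ∏ i ∈ B, (i : ℚ) ≠ 0) :
    (E.quadraticTwist d).twoDescentClass (h.quadraticTwist d) (t₁ * Units.mk0 _ hpa0) (t₂ * Units.mk0 _ hpb0) ∈
      selmerGroup (E.quadraticTwist d) 2 := by
  -- the rows in `↥Q`-form
  set χb : Q → ZMod 2 := fun j => τ₁ + (redeiLaplacian Q *ᵥ χ) j + ε * χ j with hχb
  obtain ⟨h1, h2⟩ := (rows_iff_phi3 Q ε τ₁ τ₂ χ χb).mpr ⟨rfl, hχ⟩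
  -- evenness of both supports
  obtain ⟨hsa, hsb⟩ := sum_eq_zero_of_rows Q hQ hQ4 hk h1 h2
  have hχA : χ = fun i : Q => (fun n : ℕ => if n ∈ A then (1 : ZMod 2) else 0) i := funext fun i => hindA i
  have hχB : χb = fun i : Q => (fun n : ℕ => if n ∈ B then (1 : ZMod 2) else 0) i := funext fun i => hindB i
  have hAk : Even A.card := even_card_of_sum_indicator_eq_zero Q hA (by rw [hχA] at hsa; exact hsa)
  have hBk : Even B.card := even_card_of_sum_indicator_eq_zero Q hB (by rw [hχB] at hsb; exact hsb)
  -- the rows in the inline form of part IV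
  have hrows : ∀ j ∈ Q,
      ((∑ i ∈ Q.erase j, (if jacobiSym (-(i : ℤ)) j = -1 then (1 : ZMod 2) else 0) * (if i ∈ A then 1 else 0)) +
          ((∑ i ∈ Q.erase j, (if jacobiSym (-(i : ℤ)) j = -1 then (1 : ZMod 2) else 0)) + ε) * (if j ∈ A then 1 else 0) +
          (if j ∈ B then 1 else 0) = τ₁) ∧
      ((∑ i ∈ Q.erase j, (if jacobiSym (-(i : ℤ)) j = -1 then (1 : ZMod 2) else 0) * (if i ∈ B then 1 else 0)) +
          ((∑ i ∈ Q.erase j, (if jacobiSym (-(i : ℤ)) j = -1 then (1 : ZMod 2) else 0)) + ε + 1) * (if j ∈ B then 1 else 0) +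
          (if j ∈ A then 1 else 0) = τ₂) := by
    intro j hj
    have r1 := h1 ⟨j, hj⟩
    have r2 := h2 ⟨j, hj⟩
    have e1 : (redeiLaplacian Q *ᵥ χ) ⟨j, hj⟩ =
        (∑ i ∈ Q.erase j, (if jacobiSym (-(i : ℤ)) j = -1 then (1 : ZMod 2) else 0) * (if i ∈ A then 1 else 0)) +
          (∑ i ∈ Q.erase j, (if jacobiSym (-(i : ℤ)) j = -1 then (1 : ZMod 2) else 0)) * (if j ∈ A then 1 else 0) := by
      rw [hχA]; exact mulVec_redeiLaplacian_apply_eq_sum_erase Q (fun n : ℕ => if n ∈ A then (1 : ZMod 2) else 0) ⟨j, hj⟩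
    have e2 : (redeiLaplacian Q *ᵥ χb) ⟨j, hj⟩ =
        (∑ i ∈ Q.erase j, (if jacobiSym (-(i : ℤ)) j = -1 then (1 : ZMod 2) else 0) * (if i ∈ B then 1 else 0)) +
          (∑ i ∈ Q.erase j, (if jacobiSym (-(i : ℤ)) j = -1 then (1 : ZMod 2) else 0)) * (if j ∈ B then 1 else 0) := by
      rw [hχB]; exact mulVec_redeiLaplacian_apply_eq_sum_erase Q (fun n : ℕ => if n ∈ B then (1 : ZMod 2) else 0) ⟨j, hj⟩
    have hχj : χ ⟨j, hj⟩ = (if j ∈ A then 1 else 0) := hindA ⟨j, hj⟩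
    have hχbj : χb ⟨j, hj⟩ = (if j ∈ B then 1 else 0) := hindB ⟨j, hj⟩
    rw [e1, hχj, hχbj] at r1
    rw [e2, hχj, hχbj] at r2
    exact ⟨by linear_combination r1, by linear_combination r2⟩
  exact twoDescentClass_torsion_mul_support_mem_selmerGroup E S Q h hS h2S hgood hN hQ hQS hQ4 hk hiso8 hisoS hadm hε hd
    ht hτ hA hB hAk hBk hrows hpa0 hpb0

/-! ## Selmer classes give solutions of `Φ₃` -/

/-- **Every Selmer class of the iso-class twist comes from a torsion pair and a solution of `Φ₃`.**  Setting of the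
module docstring (`Q ≠ ∅`): for `c ∈ Sel⁽²⁾(E^{(M)}/ℚ)` there are a torsion pair `(t₁,t₂)` of `E` — one of `(1,1)`,
`(δ₁, e₁−e₂)`, `(e₂−e₁, δ₂)`, `(e₃−e₁, e₃−e₂)`, with residue bits `(τ₁,τ₂) = (0,0), (1,1+ε), (ε,1), (1+ε,ε)` on `Q` — and
subsets `A, B ⊆ Q` such that: the components of `c` are `([t₁∏_A i], [t₂∏_B i])`, the indicator vector `χ_A` solves
`Φ₃(Ĝ)χ_A = (τ₂ + (ε+1)τ₁)𝟙`, and `χ_B = τ₁𝟙 + Ĝχ_A + εχ_A`.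
[cite: SilvermanAEC2009, Prop. X.1.4, Thm. X.4.2, Prop. X.4.9] [cite: Kane2013SelmerTwists, §2] -/
theorem exists_torsion_phi3_of_mem_selmerGroup (h : E.toAffine.SplitTwoTorsion e₁ e₂ e₃) (hS : ∀ ℓ ∈ S, ℓ.Prime)
    (h2S : 2 ∈ S)
    (hgood : ∀ ℓ : ℕ, (hℓ : ℓ.Prime) → ℓ ∉ S → haveI : Fact ℓ.Prime := ⟨hℓ⟩;
      padicValRat ℓ (e₁ - e₂) = 0 ∧ padicValRat ℓ (e₁ - e₃) = 0 ∧ padicValRat ℓ (e₂ - e₃) = 0)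
    (hN : ∀ ℓ : ℕ, ℓ.Prime → ℓ ∉ S → ¬ ℓ ∣ E.conductorNorm ℤ)
    (hrank : E.mordellWeilRank = 0) (hsha : ∀ x ∈ E.sha, (2 : ℕ) • x = 0 → x = 0)
    (hQ : ∀ q ∈ Q, q.Prime) (hQS : ∀ q ∈ Q, q ∉ S) (hQ4 : ∀ q ∈ Q, q % 4 = 3) (hk : Even Q.card)
    {q₀ : ℕ} (hq₀ : q₀ ∈ Q)
    (hiso8 : ∀ q ∈ Q, ∀ q' ∈ Q, q % 8 = q' % 8)
    (hisoS : ∀ q ∈ Q, ∀ q' ∈ Q, ∀ ℓ ∈ S, (hℓ : ℓ.Prime) → ℓ ≠ 2 → haveI : Fact ℓ.Prime := ⟨hℓ⟩;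
      legendreSym ℓ ((q : ℤ) * q') = 1)
    (hadm : ∀ q ∈ Q, (hq : q.Prime) → haveI : Fact q.Prime := ⟨hq⟩;
      qrBit q ((e₁ - e₂) * (e₁ - e₃)) = 1 ∧ qrBit q ((e₂ - e₁) * (e₂ - e₃)) = 1)
    {ε : ZMod 2} (hε : ∀ q ∈ Q, (hq : q.Prime) → haveI : Fact q.Prime := ⟨hq⟩; qrBit q (e₂ - e₁) = ε)
    {d : ℚ} (hd : d = ∏ q ∈ Q, (q : ℚ)) [(E.quadraticTwist d).IsElliptic]
    {c : galH1Torsion (E.quadraticTwist d) 2} (hc : c ∈ selmerGroup (E.quadraticTwist d) 2) :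
    ∃ (t₁ t₂ : ℚˣ) (τ₁ τ₂ : ZMod 2),
      ((((t₁ : ℚ) = 1 ∧ (t₂ : ℚ) = 1) ∧ τ₁ = 0 ∧ τ₂ = 0) ∨
        (((t₁ : ℚ) = (e₁ - e₂) * (e₁ - e₃) ∧ (t₂ : ℚ) = e₁ - e₂) ∧ τ₁ = 1 ∧ τ₂ = 1 + ε) ∨
        (((t₁ : ℚ) = e₂ - e₁ ∧ (t₂ : ℚ) = (e₂ - e₁) * (e₂ - e₃)) ∧ τ₁ = ε ∧ τ₂ = 1) ∨
        (((t₁ : ℚ) = e₃ - e₁ ∧ (t₂ : ℚ) = e₃ - e₂) ∧ τ₁ = 1 + ε ∧ τ₂ = ε)) ∧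
      ∃ (A B : Finset ℕ) (_ : A ⊆ Q) (_ : B ⊆ Q) (hpa0 : ∏ i ∈ A, (i : ℚ) ≠ 0) (hpb0 : ∏ i ∈ B, (i : ℚ) ≠ 0),
        kummerEquiv ℚ 2 ((E.quadraticTwist d).twoTorsionCharH1 (h.quadraticTwist d) c) =
            Additive.ofMul (QuotientGroup.mk (t₁ * Units.mk0 _ hpa0)) ∧
          kummerEquiv ℚ 2 ((E.quadraticTwist d).twoTorsionCharH1 (h.quadraticTwist d).swap₁₂ c) =
            Additive.ofMul (QuotientGroup.mk (t₂ * Units.mk0 _ hpb0)) ∧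
          (phi3 (redeiLaplacian Q) *ᵥ (fun i : Q => if (i : ℕ) ∈ A then (1 : ZMod 2) else 0) =
            fun _ => τ₂ + (ε + 1) * τ₁) ∧
          (∀ j : Q, τ₁ + (redeiLaplacian Q *ᵥ (fun i : Q => if (i : ℕ) ∈ A then (1 : ZMod 2) else 0)) j +
            ε * (if (j : ℕ) ∈ A then (1 : ZMod 2) else 0) = (if (j : ℕ) ∈ B then 1 else 0)) := by
  haveI hq₀F : Fact q₀.Prime := ⟨hQ q₀ hq₀⟩
  have hQ0 : ∀ q ∈ Q, (q : ℚ) ≠ 0 := fun q hq => by exact_mod_cast (hQ q hq).ne_zero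
  obtain ⟨a, b, ha, hb⟩ := (E.quadraticTwist d).exists_kummerEquiv_twoTorsionCharH1_pair_eq (h.quadraticTwist d) c
  obtain ⟨hevena, hevenb, t₁, t₂, htor, hga, hgb, hmka, hmkb⟩ := components_eq_torsion_mul_support E S Q h hS h2S hgood hN
    hrank hsha hQ hQS hQ4 hk hq₀ hiso8 hisoS hadm hε hd hc a b ha hb
  set A := Q.filter (fun i => parityBit i (a : ℚ) = 1) with hAdef
  set B := Q.filter (fun i => parityBit i (b : ℚ) = 1) with hBdef
  have hA : A ⊆ Q := Finset.filter_subset _ _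
  have hB : B ⊆ Q := Finset.filter_subset _ _
  have hpa0 : ∏ i ∈ A, (i : ℚ) ≠ 0 := Finset.prod_ne_zero_iff.mpr fun i hi => hQ0 i (hA hi)
  have hpb0 : ∏ i ∈ B, (i : ℚ) ≠ 0 := Finset.prod_ne_zero_iff.mpr fun i hi => hQ0 i (hB hi)
  -- components on the representatives `(t₁ ∏_A, t₂ ∏_B)`
  have hu₁ : (Units.mk0 _ hga : ℚˣ) = t₁ * Units.mk0 _ hpa0 := Units.ext (by simp)
  have hu₂ : (Units.mk0 _ hgb : ℚˣ) = t₂ * Units.mk0 _ hpb0 := Units.ext (by simp)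
  have ha' : kummerEquiv ℚ 2 ((E.quadraticTwist d).twoTorsionCharH1 (h.quadraticTwist d) c) =
      Additive.ofMul (QuotientGroup.mk (t₁ * Units.mk0 _ hpa0)) := by rw [ha, hmka, hu₁]
  have hb' : kummerEquiv ℚ 2 ((E.quadraticTwist d).twoTorsionCharH1 (h.quadraticTwist d).swap₁₂ c) =
      Additive.ofMul (QuotientGroup.mk (t₂ * Units.mk0 _ hpb0)) := by rw [hb, hmkb, hu₂]
  -- bits of the torsion pairs at the primes of `Q`
  have he12 : e₁ - e₂ ≠ 0 := sub_ne_zero.mpr h.ne₁₂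
  have he21 : e₂ - e₁ ≠ 0 := sub_ne_zero.mpr h.ne₁₂.symm
  have he13 : e₁ - e₃ ≠ 0 := sub_ne_zero.mpr h.ne₁₃
  have he23 : e₂ - e₃ ≠ 0 := sub_ne_zero.mpr h.ne₂₃
  have hbits : ∀ q ∈ Q, (hq : q.Prime) → haveI : Fact q.Prime := ⟨hq⟩;
      (parityBit q (1 : ℚ) = 0 ∧ qrBit q (1 : ℚ) = 0) ∧
      (parityBit q ((e₁ - e₂) * (e₁ - e₃)) = 0 ∧ qrBit q ((e₁ - e₂) * (e₁ - e₃)) = 1) ∧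
      (parityBit q (e₁ - e₂) = 0 ∧ qrBit q (e₁ - e₂) = 1 + ε) ∧
      (parityBit q (e₂ - e₁) = 0 ∧ qrBit q (e₂ - e₁) = ε) ∧
      (parityBit q ((e₂ - e₁) * (e₂ - e₃)) = 0 ∧ qrBit q ((e₂ - e₁) * (e₂ - e₃)) = 1) ∧
      (parityBit q (e₃ - e₁) = 0 ∧ qrBit q (e₃ - e₁) = 1 + ε) ∧
      (parityBit q (e₃ - e₂) = 0 ∧ qrBit q (e₃ - e₂) = ε) := by
    intro q hq hqp
    haveI : Fact q.Prime := ⟨hqp⟩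
    obtain ⟨g12, g13, g23⟩ := hgood q hqp (hQS q hq)
    obtain ⟨hδ₁, hδ₂⟩ := hadm q hq hqp
    have hεq := hε q hq hqp
    have hm1 : qrBit q (-1 : ℚ) = 1 := qrBit_neg_one_eq_one_of_emod_four (hQ4 q hq)
    have hq12 : qrBit q (e₁ - e₂) = 1 + ε := by rw [← neg_sub, qrBit_neg (p := q) he21, hm1, hεq]
    have hq13 : qrBit q (e₁ - e₃) = ε := by
      have := hδ₁; rw [qrBit_mul q he12 he13, hq12] at this
      revert this; generalize qrBit q (e₁ - e₃) = x
      have h2 : ε = 0 ∨ ε = 1 := by generalize ε = y; revert y; decide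
      rcases h2 with h0 | h0 <;> rw [h0] <;> revert x <;> decide
    have hq23 : qrBit q (e₂ - e₃) = 1 + ε := by
      have := hδ₂; rw [qrBit_mul q he21 he23, hεq] at this
      revert this; generalize qrBit q (e₂ - e₃) = x
      have h2 : ε = 0 ∨ ε = 1 := by generalize ε = y; revert y; decide
      rcases h2 with h0 | h0 <;> rw [h0] <;> revert x <;> decide
    have p12 : parityBit q (e₁ - e₂) = 0 := by rw [parityBit, g12, Int.cast_zero]
    have p13 : parityBit q (e₁ - e₃) = 0 := by rw [parityBit, g13, Int.cast_zero]
    have p23 : parityBit q (e₂ - e₃) = 0 := by rw [parityBit, g23, Int.cast_zero]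
    have p21 : parityBit q (e₂ - e₁) = 0 := by rw [parityBit, ← neg_sub, padicValRat.neg, g12, Int.cast_zero]
    have p31 : parityBit q (e₃ - e₁) = 0 := by rw [parityBit, ← neg_sub, padicValRat.neg, g13, Int.cast_zero]
    have p32 : parityBit q (e₃ - e₂) = 0 := by rw [parityBit, ← neg_sub, padicValRat.neg, g23, Int.cast_zero]
    refine ⟨⟨by rw [parityBit, padicValRat.one, Int.cast_zero], qrBit_one⟩, ⟨by rw [parityBit_mul he12 he13, p12, p13, add_zero], hδ₁⟩,
      ⟨p12, hq12⟩, ⟨p21, hεq⟩, ⟨by rw [parityBit_mul he21 he23, p21, p23, add_zero], hδ₂⟩,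
      ⟨p31, by rw [← neg_sub, qrBit_neg (p := q) he13, hm1, hq13]⟩, ⟨p32, ?_⟩⟩
    rw [← neg_sub, qrBit_neg (p := q) he23, hm1, hq23]
    generalize ε = y; revert y; decide
  -- for each torsion pair: rows (part V-c) and `Φ₃` (part V-a)
  have main : ∀ (τ₁ τ₂ : ZMod 2),
      (∀ q ∈ Q, (hq : q.Prime) → haveI : Fact q.Prime := ⟨hq⟩;
        parityBit q (t₁ : ℚ) = 0 ∧ parityBit q (t₂ : ℚ) = 0 ∧ qrBit q (t₁ : ℚ) = τ₁ ∧ qrBit q (t₂ : ℚ) = τ₂) →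
      (phi3 (redeiLaplacian Q) *ᵥ (fun i : Q => if (i : ℕ) ∈ A then (1 : ZMod 2) else 0) = fun _ => τ₂ + (ε + 1) * τ₁) ∧
      (∀ j : Q, τ₁ + (redeiLaplacian Q *ᵥ (fun i : Q => if (i : ℕ) ∈ A then (1 : ZMod 2) else 0)) j +
        ε * (if (j : ℕ) ∈ A then (1 : ZMod 2) else 0) = (if (j : ℕ) ∈ B then 1 else 0)) := by
    intro τ₁ τ₂ hτ
    have hrows := rows_of_torsion_mul_support_components E S Q h hgood hQ hQS hQ4 hk hadm hε hd hc hτ hA hB hevena hevenb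
      hpa0 hpb0 ha' hb'
    -- rows in `↥Q`-form
    have h12 : (∀ j : Q, (redeiLaplacian Q *ᵥ (fun i : Q => if (i : ℕ) ∈ A then (1 : ZMod 2) else 0)) j +
          ε * (if (j : ℕ) ∈ A then (1 : ZMod 2) else 0) + (if (j : ℕ) ∈ B then (1 : ZMod 2) else 0) = τ₁) ∧
        (∀ j : Q, (redeiLaplacian Q *ᵥ (fun i : Q => if (i : ℕ) ∈ B then (1 : ZMod 2) else 0)) j +
          (ε + 1) * (if (j : ℕ) ∈ B then (1 : ZMod 2) else 0) + (if (j : ℕ) ∈ A then (1 : ZMod 2) else 0) = τ₂) := by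
      constructor
      · intro j
        obtain ⟨r1, -⟩ := hrows j j.2
        rw [mulVec_redeiLaplacian_apply_eq_sum_erase Q (fun n : ℕ => if n ∈ A then (1 : ZMod 2) else 0) j]
        linear_combination r1
      · intro j
        obtain ⟨-, r2⟩ := hrows j j.2
        rw [mulVec_redeiLaplacian_apply_eq_sum_erase Q (fun n : ℕ => if n ∈ B then (1 : ZMod 2) else 0) j]
        linear_combination r2
    obtain ⟨hb, hphi⟩ := (rows_iff_phi3 Q ε τ₁ τ₂ _ _).mp h12
    exact ⟨hphi, fun j => (congrFun hb j).symm⟩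
  refine ⟨t₁, t₂, ?_⟩
  rcases htor with ⟨h₁, h₂⟩ | ⟨h₁, h₂⟩ | ⟨h₁, h₂⟩ | ⟨h₁, h₂⟩
  · refine ⟨0, 0, Or.inl ⟨⟨h₁, h₂⟩, rfl, rfl⟩, A, B, hA, hB, hpa0, hpb0, ha', hb', main 0 0 fun q hq hqp => ?_⟩
    obtain ⟨hO, -⟩ := hbits q hq hqp
    rw [h₁, h₂]; exact ⟨hO.1, hO.1, hO.2, hO.2⟩
  · refine ⟨1, 1 + ε, Or.inr (Or.inl ⟨⟨h₁, h₂⟩, rfl, rfl⟩), A, B, hA, hB, hpa0, hpb0, ha', hb',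
      main 1 (1 + ε) fun q hq hqp => ?_⟩
    obtain ⟨-, hT1, hT1', -⟩ := hbits q hq hqp
    rw [h₁, h₂]; exact ⟨hT1.1, hT1'.1, hT1.2, hT1'.2⟩
  · refine ⟨ε, 1, Or.inr (Or.inr (Or.inl ⟨⟨h₁, h₂⟩, rfl, rfl⟩)), A, B, hA, hB, hpa0, hpb0, ha', hb',
      main ε 1 fun q hq hqp => ?_⟩
    obtain ⟨-, -, -, hT2, hT2', -⟩ := hbits q hq hqp
    rw [h₁, h₂]; exact ⟨hT2.1, hT2'.1, hT2.2, hT2'.2⟩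
  · refine ⟨1 + ε, ε, Or.inr (Or.inr (Or.inr ⟨⟨h₁, h₂⟩, rfl, rfl⟩)), A, B, hA, hB, hpa0, hpb0, ha', hb',
      main (1 + ε) ε fun q hq hqp => ?_⟩
    obtain ⟨-, -, -, -, -, hT3, hT3'⟩ := hbits q hq hqp
    rw [h₁, h₂]; exact ⟨hT3.1, hT3'.1, hT3.2, hT3'.2⟩

end Param

end Summit.BirchSwinnertonDyer.BirchSwinnertonDyer.Theorems.GenusKolyvaginAtTwo.TorsionCellSEL

end
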